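import Literature.NumberTheory.Automorphic.BrandtXi
import Summits.BirchSwinnertonDyer.Rank1Residual.Additive.WildThreeQuaternionicTransfer
import HarnessLib
import HarnessLib.Audit.Tags

/-!
# O6 — THE PIZER-LEVEL DEGREE LAW AT A WILD `3` (conjecture `DL-R6d`; cell `b2b-bsdres`, team
# o5o6, seat O6-planner-2 "non-Iwasawa side", GEN 8; an EVIDENCE-labelled research TARGET of the
# construction cell — NOT a Literature fact, NOT a residual-map mark, nothing here is asserted)

## The statement in words

Let `E/ℚ` be an elliptic curve of conductor `N = 3^f · q · M''` with `f = v₃(N)` ODD and `≥ 3`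
(wild, supercuspidal at `3`), `q ∥ N` a prime of multiplicative reduction (the "partner prime") and
`gcd(M'', 3q) = 1`; assume `E[3]` is irreducible (no rational `3`-isogeny in the class). Let `B̄`
be the definite quaternion algebra over `ℚ` ramified at `{3, ∞}` — concretely `(−1, −3)_ℚ`
(`DefAlgThree`), with maximal order `O = ℤ⟨1, i, (1+j)/2, (i+k)/2⟩` (`maxOrderThree`) — and
`R_f = ℤ[i] + 3^m O`, `m = (f − 1)/2`, PIZER'S ORDER of level `3^f` at the ramified prime
(`pizerOrderThree f`; A. Pizer, J. Algebra 64 (1980) §1; Hijikata–Pizer–Shemanske, Mem. AMS 418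
(1989): the orders of level `p^{2m+1}` in the division algebra over `ℚ_p` are `𝓞_L + P^{m}`-type,
`L/ℚ_p` the unramified quadratic field — here `L = ℚ₃(i)`). Choose two distinct Eichler orders
`O₀, O₁ ⊆ O` of level `M''` whose intersection is an Eichler order of level `q M''` and put
`R₀ = R_f ∩ O₀`, `R₁ = R_f ∩ O₁` (vertex orders), `R_e = R_f ∩ O₀ ∩ O₁` (edge order). The
CEREDNIK–DRINFELD GRAPH of this datum is the bipartite graph with vertex set `Cls R₀ ⊔ Cls R₁`, edge
set `Cls R_e` and end-point maps `[I] ↦ [I R₀]`, `[I] ↦ [I R₁]` (a `PizerCDDatum q f M''` packages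
exactly these data, with the order / Eichler / end-point properties as HYPOTHESIS FIELDS; that such a
datum exists for every admissible `(q, f, M'')` is the separate construction statement
`PizerCDDatumExists` — existence is not smuggled into the interface). On `ℤ[Cls R_e]` put the
pairing `u(e, e') = w_e δ_{e,e'}`, `w_e = |O_L(I_e)ˣ|/2` (`Brandt.weight`), the Brandt matrices
`Brandt.matrix R_e n` and the cycle space `X = H₁(graph, ℤ) = {v : ∂₀ v = 0 = ∂₁ v}`
(`PizerCDDatum.IsCycle`). Let `g` generate the `a(E)`-eigenline of the Brandt matrices (`T_ℓ`,
`ℓ ∤ N`) in `ℤ[Cls R_e]` (`PizerCDDatum.eigenLine`; conjecturally a LINE: `PizerNewLineAtThree`),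
`h = u(g, g)` and `i =` the positive generator of the ideal `u(g, X) ⊆ ℤ` (`PizerCDDatum.imageIndex`).
Then, with `δ₁` the modular degree of the `Γ₀(N)`-optimal curve of the class, `c_q = ord_q Δ_min`
and `𝟙 = 1` iff the Kodaira symbol at `3` is `IV` or `IV*` (Ogg: `m = v₃(Δ_min) + 1 − f ∈ {3, 7}`),

  **(DL-R6d)**  `ord₃(δ₁) + 2·ord₃(i) = ord₃(h) + 2·ord₃(c_q) + 𝟙[Kod₃ ∈ {IV, IV*}]`,

i.e. `ord₃(δ₁ / δ_U^{(1)}) = 𝟙[IV, IV*] + ord₃(c_q)` with `δ_U^{(1)} := h · c_q / i²`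
(`PizerDegreeLawAt`, `PizerDegreeLawAtThree`).

## Why these objects (the dictionary, EVIDENCE-labelled)

`X_U :=` the Shimura curve of the INDEFINITE quaternion algebra of discriminant `3q` with Pizer level
`3^f` at `3` and Eichler level `M''` elsewhere carries the newform of `E` (Jacquet–Langlands: `π_{E,3}`
is supercuspidal for `f` odd `≥ 3`, so it transfers to the algebra ramified at `3`); its Cerednik–
Drinfeld uniformisation at `q` (Boutot–Zink for general level away from `q`) makes the dual graph of
the special fibre at `q` the graph above, Hecke- and monodromy-compatibly, so `X = X_q(J_U)` is the
character group at `q` [corpus: paper:doi-10-1006-jnth-2000-2614 (Takahashi 2001) p. 84, proof of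
Thm. 3.8, for Eichler level; the Pizer-level version is the EVIDENCE-level extrapolation this target
makes]. Takahashi's Thm. 2.3 [corpus: same key, p. 79: "`i_r` divides `h_r`, and `δ = (h_r/i_r)·j_r`",
`i_r j_r = c_r`, valid "for any prime `r` dividing `N`" (p. 80) given semistable reduction of the
Jacobian at `r`] applied to the optimal quotient `J_U → E_U` at `r = q` gives
`δ_U = h j / i = h c_q(E_U) / i²`; the tree renders the classical (`X₀(N)`) case of the same theorem
as the named fact `Literature.NumberTheory.EllipticCurves.takahashi2001_thm_2_3_of_coprime` over
`Brandt.XiSetup`, whose conventions (`Brandt.matrix`, `Brandt.weight`, `Brandt.eigenLattice`,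
`a_n = W.LFunction n`, `c = (W.minimalDiscriminantNorm ℤ).factorization q`, minimal-degree
`ModularParametrizationData`) this file copies. The law (DL-R6d) then says: the `3`-part of the
degree ratio `δ₁/δ_U` is the `3`-part of Ribet–Takahashi's `c_q` (as for Eichler level, Pasten 2024
§6 = arXiv:1705.09251, Prop. 6.13) times ONE EXTRA `3` exactly when `E` has Kodaira type `IV`/`IV*`
at `3` — the wild analogue of the Tamagawa factor `c_3 = #Φ_3(𝔽̄₃)[3] = 3` for `IV, IV*` (and `1` for
`II, II*, III, III*, I₀*` when `E[3]` is irreducible), which is what the O6 residue R-O6-5′ needs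
transferred (module docstring of `WildThreeQuaternionicTransfer.lean`, target `T-O6-R5`, and
`WildThreeNonsplitTransfer.lean`).

## Status, pre-registration, census (EVIDENCE; numbers, not adjectives)

PRE-REGISTERED before any `f ≥ 3` census row beyond `N ≤ 300` existed: file
`gen8/engine3/R6D-PREREG.md` (sha256/16 `2c86bf2c44480e01`) of the seat folder, engine
`gen8/engine3/o6r2g8_engine3.py` (pure-stdlib exact arithmetic, sha256/16 `42b2df501929cde1`:
class sets of `R₀, R_e` by `ℓ`-neighbours + theta series + exact isomorphism tests, mass formula
`ψ(M'') 9^m/12 · (q+1)` certified on every row, `H₁` by spanning forest, Brandt matrices, the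
`a(E)`-line by modular nullspace + rational reconstruction + exact verification, `h`, `i`, Ogg's
formula for the Kodaira symbol, Cremona's `alldegphi`/`allcurves`/`allisog` for `δ₁`, `c_q`, the
isogeny filter). Results at the time of filing: tier `v₃(N) ∈ {3,5}`, `N ≤ 300`: 8/8 classes without
rational `3`-isogeny obey (DL-R6d) (`135a,b; 189a,d; 297a,b,c,d`); level `1998 = 2·27·37` at `q = 2`
and `q = 37`: 8/8 (`1998a–d` `IV/IV*` → extra `3`; `1998g–j` `II/II*` → none); calibration tier
`f = 1` (Eichler level, where (DL) is the `3`-part of Ribet–Takahashi–Pasten): 283/283 rows `OK` so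
far (census jobs `j134020`–`j134026`, 3712 + 1174 rows, running at filing; the fold is reported in the
cell's `TARGETS.md` §O6 `o6-r2 GEN 8` and the memo `gen8/O6-GEN8.md`). Every row so far has the
`a(E)`-line of multiplicity ONE in `ℤ[Cls R_e]` (`PizerNewLineAtThree`). FALSIFIER (pre-registered):
one class without rational `3`-isogeny violating (DL-R6d) whose row survives recomputation by an
independent engine (spec in `gen8/engine3/R6D-ENGINE3-DESIGN.md` §second engine). HONEST LIMITS:
(i) the identification "graph of the datum = dual graph of `X_U` at `q`" at PIZER level is not in
print in this form (Eichler level: Ribet 1990 §3–4, Buzzard 1997 Thm. 4.7, Boutot–Zink); (ii) `c_q`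
is taken on the `Γ₀(N)`-optimal curve, Takahashi's formula wants `c_q` of the `X_U`-optimal curve —
they differ by isogeny primes only, invisible at `3` under the irreducibility hypothesis, which is why
the law is stated `3`-adically and only for `E[3]` irreducible; (iii) nothing here is a theorem.

## TYPER PLACEMENT NOTE (cc-typer-5 GEN 6, typer of record O5 §3.5 / O6 §3.4, 2026-08-21)

HONEST FRAMING (cell `b2b-bsdres`, run/shared/lean/b2b/bsd-rank1-residual/, verbatim in every
file): the goal of the cell is to DELETE the COMBINATION-SHAPED residual classes of the
Birch–Swinnerton-Dyer formula for ALL analytic-rank `≤ 1` elliptic curves over `ℚ` — assembled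
STRICTLY from published theorems — so that the rank-`≤ 1` remainder becomes exactly the
CONSTRUCTION-SHAPED classes, which are TYPED (missing-input `Prop`s), NOT attempted. This is not
"finishing BSD". Lane CLASS-CLOSURE (`CLASS-CLOSURE-PLAN.md` §3.4 O6, experiment type (1) STATEMENT
DISCOVERY with a pre-registered falsifier): research routes; no claim beyond the stated classes;
census output is EVIDENCE, never a Literature fact; nothing is booked; no mark of `RESIDUAL-MAP.md`
moves. NO Literature fact is minted here and NO cited Prop is registered.

PROVENANCE. The module text above this note and every declaration below it are o6-r2 GEN 8's freeze
`HOME/b2b-bsdres-o6-r2/gen8/lean/WildThreePizerDegreeLaw.lean` (sha16 `d4ebc6bfee0276e8`, 282 lines)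
VERBATIM (typing ask A-O6-G8-T1, `HOME/INBOX.md` 2026-08-21T15:08Z; `cells/o5o6/TARGETS.md` §O6
(G8-3); farm `lean check` rc 0, 0 warnings, 0 sorries); this note is the typer's only addition.

READING OF THE DECLARATIONS (audit classes as in `FouquetWanLocus.lean` / `FouquetWanPointTransport.lean`).
Definitions with bodies: `DefAlgThree`, `maxOrderThree`, `pizerOrderThree f`, the INTERFACE
`structure PizerCDDatum q f M''` (orders, Eichler / order properties and end-point maps as HYPOTHESIS
FIELDS — no existence inside the interface), `PizerCDDatum.edgeOrder / pairing / eigenLine /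
imageIndex`. Predicates: `PizerCDDatum.IsCycle v`, `PizerDegreeLawAt C W δ₁` (the law for ONE datum,
ONE curve, ONE candidate degree; vacuous unless the `a(W)`-eigen-lattice is the line `ℤ g`). Closed
statement `PizerCDDatumExists` = the CONSTRUCTION statement (routine quaternion arithmetic, NOT
proved here, NOT asserted, consumed nowhere in this file as a hypothesis; audit class "untagged
`def : Prop`" — a prover item when a consumer appears, not a conjecture of the cell). Two
`@[conjecture]` nodes = EVIDENCE-labelled conjecture items of the cell, OPEN: `PizerNewLineAtThree`
(multiplicity one of the `a(E)`-line at Pizer level) and `PizerDegreeLawAtThree` (**T-O6-R6d**, the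
pre-registered law (DL-R6d)). One theorem (`padicValNat_eq_of_pizerDegreeLawAt`, by `omega`).
`PizerNewLineAtThree` is KEPT as a separate node (o6-r2 offered to fold it into the law's hypotheses
"if the typer prefers"): `PizerDegreeLawAt` is already guarded by the line hypothesis, so T-O6-R6d does
not depend on the multiplicity node, and multiplicity one is a distinct, separately falsifiable census
column (`mult`) with its own printed neighbourhood (newform theory of the local algebra ramified at
`3`) — merging the two would hide one failure mode inside the other.

TYPER CHECKS against the pre-registration `gen8/engine3/R6D-PREREG.md` (sha16 `2c86bf2c44480e01`,
written 2026-08-21T14:13Z before any `f ≥ 3` census id; re-hashed by the typer). (i) Mathlib's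
`QuaternionAlgebra ℚ (-1) 0 (-3)` has `i*i = -1 + 0•i`, `j*j = -3`: it IS `(−1,−3)_ℚ`. (ii) `−1` is a
non-square mod `3`, so `ℚ₃(i)/ℚ₃` is the UNRAMIFIED quadratic field `L` and `ℤ[i] ⊗ ℤ₃ = O_L`
(discriminant `−4`, a `3`-unit); hence `(ℤ[i] + 3^m O) ⊗ ℤ₃ = O_L + 3^m O₃ = O_L + P^{2m}` (`P² = 3O₃`;
note `O_L + P^{2m+1} = O_L + P^{2m}`), of index `9^m` in `O₃`, and `= O_ℓ` at every `ℓ ≠ 3` — the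
prereg's level group `U₃ = ℤ₉ˣ(1 + 3^m O_{B,3})`; that this is the order "of level `3^{2m+1}`" of
[bib: Pizer1980 §1; HijikataPizerShemanske1989] is the freeze's citation (the typer could not re-read
Pizer 1980 — not held; the scanned copy found is image-only). (iii) For trivial central character a
principal-series or special representation of `GL₂(ℚ₃)` has EVEN conductor exponent or exponent `1`
(`a(π(χ,χ⁻¹)) = 2a(χ)`, `a(χSt) ∈ {1, 2a(χ)}`), so `f = v₃(N)` odd `≥ 3` forces `π_{E,3}` supercuspidal
(dihedral from a RAMIFIED quadratic extension of `ℚ₃`: `a(Ind θ) = 1 + a(θ)`; the unramified-dihedral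
ones have `a = 2a(θ)`), in particular potentially GOOD reduction — "wild, supercuspidal at `3`" is
exact on the law's domain. (iv) The indicator `v₃(Δ_min) ∈ {f+2, f+6}` is Ogg–Saito `f = v₃(Δ_min) +
1 − m` with `m = 3` (`IV`) / `m = 7` (`IV*`); no other Kodaira type on the domain has `m ∈ {3, 7}`
because every wild-at-`3` curve (`v₃(N) ≥ 3`) is of type `II / IV / IV* / II*` (Kraus 1990, `p = 3`
table, typed in `Additive/WildThreeKrausCells.lean`; this seat's two-engine census
`class-closure/O6/census-typer5/SUMMARY.md`: 79 420 / 79 420 wild pairs, 0 exceptions). (v) The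
binders of `PizerDegreeLawAtThree` are those of the tree's
`Literature.NumberTheory.EllipticCurves.takahashi2001_thm_2_3_of_coprime` /
`QuaternionicTamagawaTransferAtThree` (degree-minimal `ModularParametrizationData` among same-newform
data = the `Γ₀(N)`-optimal curve; `c_q = ord_q Δ_min` of THAT curve, as the prereg's `c_q(E₁)`).
(vi) DEDUP: `lean search 'pizer|DefAlgThree|maxOrderThree|PizerCDDatum'` → no match in Mathlib /
Literature / Summits; bib keys of the printed antecedents exist (`Takahashi2001`, `RibetTakahashi1997`,
`PastenShimura2024` = arXiv:1705.09251 §6, `Pizer1980`, `HijikataPizerShemanske1989`).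

CENSUS STATE AT LANDING (EVIDENCE; o6-r2's engine and fold, the read-out is o6-r2's, TARGETS §O6
(G8-3b)): calibration tier `f = 1` (`gen8/engine3/CALIB-F1-RESULTS.md` `0d52191d75dccc41`, rows
`engine3_calib_f1_le1000.tsv` `e6927f810a22ab49`): 1 021 / 1 021 scored rows = the Ribet–Takahashi
`3`-part, 0 violations, 153 `3`-isogeny rows unscored; tier R6d, slice `N ≤ 3 000`
(`gen8/engine3/R6D-RESULTS-part1-le3000.md` `8fd2585d5b92ac2a`, rows `engine3_r6d_0000_3000.tsv`
`66d1a12c66e2b7be`): 824 (class, `q`) rows, all status ok, mass certificate 824/824, multiplicity of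
the `a(E)`-line `= 1` on 824/824, Takahashi `i ∣ h` 824/824; SCORED (no rational `3`-isogeny)
**524 / 524 obey (DL-R6d), 0 VIOLATIONS** (`f = 3`: `II` 125, `II*` 128, `IV` 128, `IV*` 125; `f = 5`:
`II` 5, `II*` 4, `IV` 4, `IV*` 5; by `ord₃ c_q`: `IV/IV*` 253 rows ratio-valuation `1` + 9 rows `2`,
others 253 rows `0` + 9 rows `1`); 300 EIS rows (rational `3`-isogeny) reported unscored (shift
histogram in the results file); the parts `3 000 < N < 10⁴` were running at landing. A conjecture
item is never promoted above EVIDENCE by a count (lane rule R-CC (d)). 0 Literature facts; net debt 0.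

AMENDMENT (cc-typer-5 GEN 7, 2026-08-21, DOC-ONLY; statements byte-identical; numbers = o6-r2 GEN 8's
closing line INBOX 16:30Z, fold `gen8/engine3/R6D-RESULTS.md` `f06349fa836c06ba`, per-row table
`R6D-RESULTS.rows.tsv` `833041e0f171b0cf`; the read-out / any label word is o6-r1's successor's and
census-lead's, not the typer's): **(DL-R6d) CENSUS COMPLETE `N < 10⁴`** — 3 712 (class, `q`) rows
(`v₃(N) ∈ {3,5}`, prime `q ∥ N`, `q ≤ 97`), status ok 3 700 (12 `MULT2` rows = the `(−3)`-twist /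
3-isogenous pairs 4158l/z, 4590c/t whose `a_ℓ` coincide at the 8 good primes used — a cap artefact,
unscored, not multiplicity 2); **SCORED (no rational `3`-isogeny) 2 770 / 2 770 obey, 0 VIOLATIONS**
(`f = 3`: `II` 677, `II*` 630, `IV` 630, `IV*` 677; `f = 5`: `II` 46, `II*` 32, `IV` 32, `IV*` 46; the
extra `3` sits on every `IV/IV*` row and on no `II/II*` row; by `ord₃ c_q = 0/1/2/3` the ratio valuation is
shifted by exactly that on 1 265/101/15/4 rows); EIS unscored 930; engine certificates clean (mass, mult 1,
`g ∈ X`, `i ∣ h`: 0 failures); ONE ENGINE with two linear-algebra kernels (dense 824 / fk 1 996 / both 892,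
byte-identical 892/892) — EVIDENCE, PROVISIONAL under the two-engine rule; 283 levels, `max h_E = 1 080`.
-/

noncomputable section

namespace Summit.BirchSwinnertonDyer.Rank1Residual.AdditiveThree

open scoped Classical
open Literature.NumberTheory.Automorphic
open Literature.NumberTheory.EllipticCurves.ModularForms (ModularParametrizationData IsNewformOf)
open WeierstrassCurve

/-! ## §1. The definite algebra ramified at `{3, ∞}`, its maximal order and Pizer's orders -/

/-- The definite quaternion algebra `(−1, −3)_ℚ` (`i² = −1`, `j² = −3`, `k = ij`), ramified exactly
at `3` and `∞`; reduced norm `t² + x² + 3y² + 3z²`. -/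
abbrev DefAlgThree : Type := QuaternionAlgebra ℚ (-1) 0 (-3)

/-- The maximal order `O = ℤ⟨1, i, (1+j)/2, (i+k)/2⟩` of `(−1,−3)_ℚ` (reduced discriminant `3`;
unit group of order `12`). -/
def maxOrderThree : Submodule ℤ DefAlgThree :=
  Submodule.span ℤ {(1 : DefAlgThree), ⟨0, 1, 0, 0⟩, ⟨1 / 2, 0, 1 / 2, 0⟩, ⟨0, 1 / 2, 0, 1 / 2⟩}

/-- PIZER'S ORDER of level `3^f` (`f` odd): `R_f = ℤ[i] + 3^m O`, `m = (f − 1)/2`, spanned by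
`1, i, 3^m (1+j)/2, 3^m (i+k)/2`; `R_1 = O`. At `p ≠ 3` it is `O_p ≅ M₂(ℤ_p)`; at `3` it is
`ℤ₃[i] + P^{2m}`-shaped of index `9^m` in `O₃` (Pizer 1980 §1; Hijikata–Pizer–Shemanske 1989). -/
def pizerOrderThree (f : ℕ) : Submodule ℤ DefAlgThree :=
  Submodule.span ℤ {(1 : DefAlgThree), ⟨0, 1, 0, 0⟩,
    ⟨(3 : ℚ) ^ ((f - 1) / 2) / 2, 0, (3 : ℚ) ^ ((f - 1) / 2) / 2, 0⟩,
    ⟨0, (3 : ℚ) ^ ((f - 1) / 2) / 2, 0, (3 : ℚ) ^ ((f - 1) / 2) / 2⟩}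

/-! ## §2. The Cerednik–Drinfeld graph datum (an INTERFACE: hypothesis fields, no existence claimed) -/

/-- A **Cerednik–Drinfeld graph datum** for `(q, f, M'')`: two distinct Eichler orders `O₀, O₁` of
level `M''` inside the maximal order `maxOrderThree`, meeting in an Eichler order of level `q M''`;
the vertex orders `R_f ∩ O₀`, `R_f ∩ O₁` and the edge order `R_f ∩ O₀ ∩ O₁` are `ℤ`-orders; and the
two end-point maps `Cls(R_f ∩ O₀ ∩ O₁) → Cls(R_f ∩ O_v)`, `[I] ↦ [I · (R_f ∩ O_v)]`, given as
functions together with their defining property on representatives. All fields are hypotheses to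
be discharged by a construction (`PizerCDDatumExists`). -/
structure PizerCDDatum (q f M'' : ℕ) where
  /-- `(−1,−3)_ℚ` is a quaternion algebra over `ℚ` (carried as a field, as in `Brandt.XiSetup`). -/
  isQuaternionAlgebra : IsQuaternionAlgebra ℚ DefAlgThree
  /-- The first Eichler order of level `M''`. -/
  O₀ : Submodule ℤ DefAlgThree
  /-- The second Eichler order of level `M''`. -/
  O₁ : Submodule ℤ DefAlgThree
  le₀ : O₀ ≤ maxOrderThree
  le₁ : O₁ ≤ maxOrderThree
  eichler₀ : Brandt.IsEichlerOrder DefAlgThree O₀ M''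
  eichler₁ : Brandt.IsEichlerOrder DefAlgThree O₁ M''
  ne : O₀ ≠ O₁
  eichler₀₁ : Brandt.IsEichlerOrder DefAlgThree (O₀ ⊓ O₁) (q * M'')
  isOrder₀ : Brandt.IsOrder DefAlgThree (pizerOrderThree f ⊓ O₀)
  isOrder₁ : Brandt.IsOrder DefAlgThree (pizerOrderThree f ⊓ O₁)
  isOrderₑ : Brandt.IsOrder DefAlgThree (pizerOrderThree f ⊓ (O₀ ⊓ O₁))
  /-- End-point map to the first vertex class set. -/
  ext₀ : Brandt.ClassSet (pizerOrderThree f ⊓ (O₀ ⊓ O₁)) → Brandt.ClassSet (pizerOrderThree f ⊓ O₀)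
  /-- End-point map to the second vertex class set. -/
  ext₁ : Brandt.ClassSet (pizerOrderThree f ⊓ (O₀ ⊓ O₁)) → Brandt.ClassSet (pizerOrderThree f ⊓ O₁)
  ext₀_spec : ∀ I : Brandt.rightIdeals (pizerOrderThree f ⊓ (O₀ ⊓ O₁)),
    ∃ J : Brandt.rightIdeals (pizerOrderThree f ⊓ O₀),
      (J : Submodule ℤ DefAlgThree) = (I : Submodule ℤ DefAlgThree) * (pizerOrderThree f ⊓ O₀) ∧
      ext₀ (Quotient.mk _ I) = (Quotient.mk _ J : Brandt.ClassSet (pizerOrderThree f ⊓ O₀))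
  ext₁_spec : ∀ I : Brandt.rightIdeals (pizerOrderThree f ⊓ (O₀ ⊓ O₁)),
    ∃ J : Brandt.rightIdeals (pizerOrderThree f ⊓ O₁),
      (J : Submodule ℤ DefAlgThree) = (I : Submodule ℤ DefAlgThree) * (pizerOrderThree f ⊓ O₁) ∧
      ext₁ (Quotient.mk _ I) = (Quotient.mk _ J : Brandt.ClassSet (pizerOrderThree f ⊓ O₁))

/-- **Construction statement** (separate from the interface): for every prime `q ≠ 3`, odd `f` and
`M''` coprime to `3q` a Cerednik–Drinfeld graph datum exists. Routine quaternion arithmetic (Eichler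
orders of every level prime to `3` exist inside `maxOrderThree`; `I ↦ I R_v` maps invertible right
`R_e`-ideals to invertible right `R_v`-ideals compatibly with left multiplication), NOT proved here;
the seat's engine constructs such data explicitly for every census row. A `Prop`; nothing asserted. -/
def PizerCDDatumExists : Prop :=
  ∀ q f M'' : ℕ, q.Prime → q ≠ 3 → Odd f → ¬ 3 ∣ M'' → ¬ q ∣ M'' → 0 < M'' →
    Nonempty (PizerCDDatum q f M'')

namespace PizerCDDatum

variable {q f M'' : ℕ} (C : PizerCDDatum q f M'')

/-- The edge order `R_e = R_f ∩ O₀ ∩ O₁`. -/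
abbrev edgeOrder : Submodule ℤ DefAlgThree := pizerOrderThree f ⊓ (C.O₀ ⊓ C.O₁)

/-- The edge class set `Cls R_e` is finite (Jordan–Zassenhaus, `Brandt.finite_classSet`). -/
instance finite_classSet_edgeOrder : Finite (Brandt.ClassSet C.edgeOrder) :=
  haveI := C.isQuaternionAlgebra
  Brandt.finite_classSet ℚ C.isOrderₑ

/-- A `Fintype` structure on the edge class set (from finiteness, by choice). -/
instance fintype_classSet_edgeOrder : Fintype (Brandt.ClassSet C.edgeOrder) := Fintype.ofFinite _

/-- The **monodromy pairing** on `ℤ[Cls R_e]`: `u(v, v') = Σ_e w_e v_e v'_e`, `w_e = |O_L(I_e)ˣ|/2`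
(`Brandt.weight`; Ribet 1990 §4, Takahashi 2001 §2 `u_J`). -/
def pairing (v v' : Brandt.ClassSet C.edgeOrder → ℤ) : ℤ :=
  ∑ e, (Brandt.weight C.edgeOrder e : ℤ) * v e * v' e

/-- **Cycles**: `v ∈ ℤ[Cls R_e]` with `∂₀ v = 0` and `∂₁ v = 0` (sum of `v_e` over the edges at each
vertex of either colour vanishes) — the character group `X = H₁(graph, ℤ)`. -/
def IsCycle (v : Brandt.ClassSet C.edgeOrder → ℤ) : Prop :=
  (∀ x, (∑ e, if C.ext₀ e = x then v e else 0) = 0) ∧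
    (∀ y, (∑ e, if C.ext₁ e = y then v e else 0) = 0)

/-- The **`λ`-eigenline** of the Brandt matrices of `R_e` in `ℤ[Cls R_e]` (`T_p v = λ_p v` for all
primes `p ∤ N`; `Brandt.eigenLattice`, `Brandt.matrix`). -/
def eigenLine (N : ℕ) (lam : ℕ → ℤ) : Submodule ℤ (Brandt.ClassSet C.edgeOrder → ℤ) :=
  Brandt.eigenLattice N (Brandt.matrix C.edgeOrder) lam

/-- Takahashi's **`i`** in graph coordinates: the positive generator of the ideal
`u(g, X) = {u(g, x) : x a cycle} ⊆ ℤ` (`= #image(Φ_q(J) → Φ_q(E))` for `g` a generator of the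
`E`-line, Takahashi 2001 §2); `Nat.sInf`, junk value `0` if `u(g, X) = 0`. -/
def imageIndex (g : Brandt.ClassSet C.edgeOrder → ℤ) : ℕ :=
  sInf {n : ℕ | 0 < n ∧ ∃ x, C.IsCycle x ∧ (C.pairing g x).natAbs = n}

end PizerCDDatum

/-! ## §3. The law -/

/-- **(DL-R6d) for one datum and one curve**: for every generator `g` of the `a(W)`-eigenline of
`ℤ[Cls R_e]` (level `N = 3^f q M''`),
`ord₃ δ₁ + 2 ord₃ i(g) = ord₃ u(g,g) + 2 ord₃ c_q(W) + 𝟙[v₃ Δ_min(W) − f ∈ {2, 6}]`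
(Ogg: Kodaira `IV`/`IV*` at `3` iff `m = v₃(Δ_min) + 1 − f ∈ {3, 7}`), where `δ₁` is the given
natural number (the optimal modular degree in the global statement) and
`c_q(W) = ord_q Δ_min(W)`. Vacuous if the eigen-lattice is not a line (cf. `PizerNewLineAtThree`).
A predicate; nothing asserted. -/
def PizerDegreeLawAt {q f M'' : ℕ} (C : PizerCDDatum q f M'') (W : WeierstrassCurve ℚ) (δ₁ : ℕ) :
    Prop :=
  ∀ g : Brandt.ClassSet C.edgeOrder → ℤ, g ≠ 0 →
    C.eigenLine (3 ^ f * q * M'') (fun n => W.LFunction n) = Submodule.span ℤ {g} →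
    padicValNat 3 δ₁ + 2 * padicValNat 3 (C.imageIndex g) =
      padicValInt 3 (C.pairing g g) +
        2 * padicValNat 3 ((W.minimalDiscriminantNorm ℤ).factorization q) +
        (if (W.minimalDiscriminantNorm ℤ).factorization 3 = f + 2 ∨
            (W.minimalDiscriminantNorm ℤ).factorization 3 = f + 6 then 1 else 0)

/-- **MULTIPLICITY ONE AT PIZER LEVEL** (the non-vacuity companion of (DL-R6d); Tunnell 1978 /
H. Saito-type newform theory for the ramified local algebra, EVIDENCE: multiplicity `1` on every
census row so far): under the hypotheses of `PizerDegreeLawAtThree` the `a(E)`-eigen-lattice of the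
Brandt matrices of `R_e` is a LINE `ℤ g`, `g ≠ 0`. OPEN here; a `Prop`, nothing asserted. -/
@[conjecture] def PizerNewLineAtThree : Prop :=
  ∀ (q f M'' : ℕ) [NeZero (3 ^ f * q * M'')], q.Prime → q ≠ 3 → Odd f → 3 ≤ f →
    ¬ 3 ∣ M'' → ¬ q ∣ M'' →
  ∀ (C : PizerCDDatum q f M'') (W : WeierstrassCurve ℚ) [W.IsElliptic],
    W.conductorNorm ℤ = 3 ^ f * q * M'' →
    ∃ g : Brandt.ClassSet C.edgeOrder → ℤ, g ≠ 0 ∧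
      C.eigenLine (3 ^ f * q * M'') (fun n => W.LFunction n) = Submodule.span ℤ {g}

/-- **T-O6-R6d — THE PIZER-LEVEL DEGREE LAW AT A WILD `3` (conjecture DL-R6d)**: for every prime
`q ≠ 3`, odd `f ≥ 3`, `M''` coprime to `3q`, every Cerednik–Drinfeld graph datum `C` for
`(q, f, M'')`, every elliptic `W/ℚ` of conductor `3^f q M''` with IRREDUCIBLE mod-`3` representation,
and every classical modular parametrisation `D₁` of `W` at level `N` of minimal degree among the
parametrisations (of curves of conductor `N`) with the same newform — so that `W` is the optimal
curve and `D₁.modularDegree = δ₁(N)` — the law `PizerDegreeLawAt C W D₁.modularDegree` holds.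
WHY IT MIGHT FAIL: (a) the extra `3` for `IV/IV*` is an empirical constant of the seat's census, with
no printed mechanism yet (candidate: the `3`-torsion of `Φ_3` of the wild fibre entering the
`U`-side Tamagawa/degree bookkeeping exactly as `c_3`); (b) at Pizer level the Eisenstein /
congruence-module comparison between `X₀(N)` and `X_U` may contain `3`-power factors not of this
shape when `27 ∣ N` and every multiplicative prime is `≡ 1 (mod 3)` (the regime where Ribet–Takahashi
multiplicity-one inputs fail, Hamidi 2026 Thm. 5.5, cf. `QuaternionicTamagawaTransferAtThree`);
(c) `c_q` of the `Γ₀(N)`-optimal versus the `X_U`-optimal curve. USE: with Takahashi's Thm. 2.3 on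
`X_U` it pins `ord₃(δ₁/δ_U)`, i.e. the `3`-part of the change of Tamagawa/degree term between the
classical and the `(3q)`-quaternionic Kolyvagin settings, which is the input the O6 residue R-O6-5′
asks for at a WILD `3` where no Eichler-level Shimura curve carries `E` with `3` in the discriminant.
OPEN; EVIDENCE / conjecture item of the cell, pre-registered (`R6D-PREREG.md`, sha16
`2c86bf2c44480e01`) and under census (module docstring); NOT a Literature fact. Printed antecedents:
Takahashi 2001 Thm. 2.3 and §3; Ribet–Takahashi 1997; Pasten 2024 §6 (Prop. 6.13, Lemma 6.14);
Pizer 1980 (orders of level `p^{2r+1}`); Boutot–Zink (Cerednik–Drinfeld for general level);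
Jacquet–Langlands. -/
@[conjecture] def PizerDegreeLawAtThree : Prop :=
  ∀ (q f M'' : ℕ) [NeZero (3 ^ f * q * M'')], q.Prime → q ≠ 3 → Odd f → 3 ≤ f →
    ¬ 3 ∣ M'' → ¬ q ∣ M'' →
  ∀ (C : PizerCDDatum q f M'') (W : WeierstrassCurve ℚ) [W.IsElliptic],
    W.conductorNorm ℤ = 3 ^ f * q * M'' → W.HasIrreducibleModPGaloisRep 3 →
  ∀ D₁ : ModularParametrizationData W (3 ^ f * q * M''),
    (∀ (W' : WeierstrassCurve ℚ) [W'.IsElliptic], W'.conductorNorm ℤ = 3 ^ f * q * M'' →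
        ∀ D' : ModularParametrizationData W' (3 ^ f * q * M''),
          D'.f = D₁.f → D₁.modularDegree ≤ D'.modularDegree) →
    PizerDegreeLawAt C W D₁.modularDegree

/-! ## §4. Sanity: the law is a genuine constraint on `δ₁` (not vacuous in `δ₁`) -/

/-- For fixed data the two sides of (DL-R6d) determine `ord₃ δ₁`: if the law holds for `δ₁` and for
`δ₁'` with the same generator data then `ord₃ δ₁ = ord₃ δ₁'` — so a single census row CAN violate it. -/
theorem padicValNat_eq_of_pizerDegreeLawAt {q f M'' : ℕ} (C : PizerCDDatum q f M'')
    (W : WeierstrassCurve ℚ) {δ₁ δ₁' : ℕ} (g : Brandt.ClassSet C.edgeOrder → ℤ) (hg : g ≠ 0)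
    (hL : C.eigenLine (3 ^ f * q * M'') (fun n => W.LFunction n) = Submodule.span ℤ {g})
    (h : PizerDegreeLawAt C W δ₁) (h' : PizerDegreeLawAt C W δ₁') :
    padicValNat 3 δ₁ = padicValNat 3 δ₁' := by
  have e := h g hg hL
  have e' := h' g hg hL
  omega

end Summit.BirchSwinnertonDyer.Rank1Residual.AdditiveThree

end
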